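import Summits.NavierStokesRegularity.NavierStokesRegularity.Theses.SelfMixingDichotomy
import Summits.NavierStokesRegularity.NavierStokesRegularity.Theorems.SelfMixingDichotomyMixingPayoffWindowRegularity
import Summits.NavierStokesRegularity.NavierStokesRegularity.Theorems.SelfMixingDichotomyMixingPayoffAdvectionDiffusionSchwartz
import Summits.NavierStokesRegularity.NavierStokesRegularity.Theorems.SelfMixingDichotomyMixingPayoffAdmissibleDriftHeatClass
import Summits.NavierStokesRegularity.NavierStokesRegularity.Theorems.SelfMixingDichotomyMixingPayoffAdmissibleMinPrinciple
import Summits.NavierStokesRegularity.NavierStokesRegularity.Theorems.SelfMixingDichotomyMixingPayoffDriftHeatBumpFloor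
import Summits.NavierStokesRegularity.NavierStokesRegularity.Theorems.SelfMixingDichotomyMixingPayoffTypeIFloorAssembly
import Literature.Analysis.FluidPDE.DissipatesAtScale
import HarnessLib

/-!
# Route SelfMixingDichotomy — crux `MixingPayoff` (stmt-NavierStokesRegularity-1422), line `birth`:
# the kernel-checked reduction of the crux to its open heart

Support file (`--supports stmt-NavierStokesRegularity-1422`). Line `birth` splits the crux

  P = `MixingPayoff`: there is an absolute `δ > 0` such that a classical Leray–Hopf solution
  (`ν = 1`, rapidly decaying datum) whose drift is cofinally `δ`-dissipation-enhancing at `(T, x₀)`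
  (`DissipatesAtScale u T x₀ r δ` for all small `r`) is bounded near `(T, x₀)`,

along the local Type-I velocity bound `√(T − t)‖u(t,x)‖ ≤ K`. The two "known" halves of the split
have landed in this directory, fully proved:

* **W** (`mixingPayoff_scalarSlabWellposed`, from `stub_windowRegularity` + `stub_advectionDiffusionSchwartz`):
  on every window `[T − r², T − r²/2] ⊂ [0, T)` each `C_c^∞` datum launches a MIX-admissible
  passive scalar (jointly smooth, uniformly rapidly decaying, solving `∂ₜθ + ⟪u, ∇θ⟫ = Δθ`);
* **F** (`mixingPayoff_typeIFloor`, from `stub_typeIFloorAssembly` + `stub_admissibleDriftHeatClass`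
  + `stub_admissibleMinPrinciple` + `stub_driftHeatBumpFloor`): under a Type-I(K) bound at
  `(T, x₀)` a scale-`r` bump keeps more than the fraction `c₁(K)²` of its `L²` mass after half a
  diffusive time, for all small `r` — so Type-I(K) points are never cofinally `δ`-mixing for
  `δ < c₁(K)`.

This file records what they buy: the crux is **equivalent** to its open heart

  H: there are absolute `δ > 0`, `K > 0` such that every standing solution that is cofinally
  `δ`-mixing at `(T, x₀)` obeys the Type-I(K) velocity bound on some parabolic cylinder at `(T, x₀)`

(`mixingPayoff_iff_mixingForcesTypeI`; H is the registered stub `stub_mixingForcesTypeI` of the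
line's skeleton `Cruxes/MixingPayoff/Lines/birth.lean`). `H → P` is the skeleton's composition
(`δ* = min δ_H (c₁(K)/2)`: cofinal `δ*`-mixing ⇒ Type-I(K) by H ⇒ floor scale by F ⇒ a bump scalar
from W contradicts `MIX(r, δ*)`); `P → H` is elementary (bounded near `(T, x₀)` ⇒ Type-I(K) for
every `K > 0` by shrinking the cylinder; we take `K = 1`). Hence the ENTIRE open content of the crux
is H: no blow-up with unbounded Type-I ratio is cofinally `δ`-self-mixing at the parabolic scales
(`Literature.Barriers.NavierStokesRegularity.EnergySupercriticality` bites exactly here).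

No named fact is taken as a hypothesis: everything below is unconditional.
-/

noncomputable section

open Literature.Analysis.FluidPDE MeasureTheory Set Function Metric
open scoped ContDiff

-- `Summit = Problem` for this summit; the tree lakefile sets `weak.linter.dupNamespace = false`,
-- made explicit here for out-of-tree `lean check`.
set_option linter.dupNamespace false

namespace Summit.NavierStokesRegularity.NavierStokesRegularity.Theorems

open Summit.NavierStokesRegularity.NavierStokesRegularity.Theses.SelfMixingDichotomy (MixingPayoff)

local notation "E3" => EuclideanSpace ℝ (Fin 3)

/-! ### W and F in the route's vocabulary -/

/-- **W — well-posedness of the passive-scalar problem on a window.** For a standing solution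
(`0 < T`, classical on `[0,T)`, Leray–Hopf from `u 0`, rapidly decaying datum) and `0 < r`,
`r² < T`, every `C_c^∞` datum `θ₀` launches a MIX-admissible scalar on `[T − r², T − r²/2]`
starting from it: the drift has all space–time derivatives bounded on the closed window
(`stub_windowRegularity`, Tao 2011) and the linear parabolic Cauchy problem is solvable in the
Schwartz-type class (`stub_advectionDiffusionSchwartz`). -/
theorem mixingPayoff_scalarSlabWellposed :
    ∀ (T : ℝ) (u : ℝ → E3 → E3) (p : ℝ → E3 → ℝ), 0 < T →
    IsClassicalNSSolutionOn (Set.Ico 0 T) 1 0 u p → IsLerayHopfOn T 1 0 (u 0) u →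
    HasRapidSpatialDecay (u 0) →
    ∀ r : ℝ, 0 < r → r ^ 2 < T →
    ∀ θ₀ : E3 → ℝ, ContDiff ℝ ∞ θ₀ → HasCompactSupport θ₀ →
    ∃ θ : ℝ → E3 → ℝ,
      IsSmoothSpaceTimeOn (Set.Icc (T - r ^ 2) (T - r ^ 2 / 2)) θ ∧
      HasUniformRapidDecayOn (Set.Icc (T - r ^ 2) (T - r ^ 2 / 2)) θ ∧
      (∀ t ∈ Set.Icc (T - r ^ 2) (T - r ^ 2 / 2), ∀ x : E3,
        timeDerivWithin (Set.Icc (T - r ^ 2) (T - r ^ 2 / 2)) θ t x + inner ℝ (u t x) (gradient (θ t) x)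
          = Laplacian.laplacian (θ t) x) ∧
      θ (T - r ^ 2) = θ₀ := by
  intro T u p hT hcl hLH hdec r hr hrT θ₀ hθ₀ hθ₀c
  have ha : (0 : ℝ) ≤ T - r ^ 2 := by linarith
  have hab : T - r ^ 2 < T - r ^ 2 / 2 := by nlinarith
  have hb : T - r ^ 2 / 2 < T := by nlinarith
  obtain ⟨hsm, hbd⟩ :=
    stub_windowRegularity T u p hT hcl hLH hdec (T - r ^ 2) (T - r ^ 2 / 2) ha hab hb
  exact stub_advectionDiffusionSchwartz (T - r ^ 2) (T - r ^ 2 / 2) hab u hsm hbd θ₀ hθ₀ hθ₀c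

/-- **F — the bounded-drift floor under a Type-I bound.** For every `K > 0` there is `c₁(K) > 0`
such that at a point `(T, x₀)` where a classical solution on `[0,T)` obeys the Type-I(K) velocity
bound on a parabolic cylinder, for all small `r` every MIX-admissible scalar with bump datum
satisfies `c₁² ∫ θ(T − r²)² < ∫ θ(T − r²/2)²` (class bridge `stub_admissibleDriftHeatClass`,
minimum principle `stub_admissibleMinPrinciple`, Gaussian floor `stub_driftHeatBumpFloor`,
glued by `stub_typeIFloorAssembly`). In particular Type-I(K) points are never cofinally
`δ`-mixing for `δ < c₁(K)`. -/
theorem mixingPayoff_typeIFloor :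
    ∀ K : ℝ, 0 < K → ∃ c₁ : ℝ, 0 < c₁ ∧
    ∀ (T : ℝ) (u : ℝ → E3 → E3) (p : ℝ → E3 → ℝ), 0 < T →
    IsClassicalNSSolutionOn (Set.Ico 0 T) 1 0 u p → ∀ x₀ : E3,
    (∃ r₁ : ℝ, 0 < r₁ ∧ ∀ t ∈ Set.Ioo (T - r₁ ^ 2) T, ∀ x ∈ Metric.ball x₀ r₁,
      Real.sqrt (T - t) * ‖u t x‖ ≤ K) →
    ∃ r₂ : ℝ, 0 < r₂ ∧ ∀ r ∈ Set.Ioo 0 r₂, ∀ θ : ℝ → E3 → ℝ,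
      IsSmoothSpaceTimeOn (Set.Icc (T - r ^ 2) (T - r ^ 2 / 2)) θ →
      HasUniformRapidDecayOn (Set.Icc (T - r ^ 2) (T - r ^ 2 / 2)) θ →
      (∀ t ∈ Set.Icc (T - r ^ 2) (T - r ^ 2 / 2), ∀ x : E3,
        timeDerivWithin (Set.Icc (T - r ^ 2) (T - r ^ 2 / 2)) θ t x + inner ℝ (u t x) (gradient (θ t) x)
          = Laplacian.laplacian (θ t) x) →
      (∀ x, 0 ≤ θ (T - r ^ 2) x) → (∀ x, θ (T - r ^ 2) x ≤ 1) →
      (∀ x ∈ Metric.closedBall x₀ (r / 2), θ (T - r ^ 2) x = 1) →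
      Function.support (θ (T - r ^ 2)) ⊆ Metric.ball x₀ r →
      c₁ ^ 2 * ∫ x, (θ (T - r ^ 2) x) ^ 2 < ∫ x, (θ (T - r ^ 2 / 2) x) ^ 2 :=
  stub_typeIFloorAssembly stub_admissibleDriftHeatClass stub_admissibleMinPrinciple
    stub_driftHeatBumpFloor

/-! ### The crux is equivalent to its open heart -/

/-- **`MixingPayoff` ⇔ H (the open heart of line `birth`).** The crux holds if and only if there
are absolute `δ > 0`, `K > 0` such that every standing solution (`0 < T`, classical on `[0,T)`,
Leray–Hopf from `u 0`, rapidly decaying datum) that is cofinally `δ`-mixing at `(T, x₀)`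
(`DissipatesAtScale u T x₀ r δ` for all `r ∈ (0, r₀)`) obeys the Type-I(K) velocity bound
`√(T − t)‖u(t,x)‖ ≤ K` on some parabolic cylinder `(T − r₁², T) × B(x₀, r₁)`.
`→`: with `δ` from the crux and `K = 1`, cofinal mixing gives boundedness `‖u‖ ≤ M` on
`(T − ρ², T) × B(x₀, ρ)`, and on the smaller cylinder of radius `r₁ = min ρ (1/(max M 0 + 1))` one
has `√(T − t)‖u‖ < r₁ (max M 0 + 1) ≤ 1`. `←`: take `δ_H, K` from H and `c₁ = c₁(K)` from
`mixingPayoff_typeIFloor`, and put `δ* = min δ_H (c₁/2)`; given cofinal `δ*`-mixing at `(T, x₀)`,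
monotonicity (`DissipatesAtScale.mono`) gives cofinal `δ_H`-mixing, H gives Type-I(K), F a floor
scale `r₂`; at a scale `r < min r₀ r₂` with `r² < T`, W (`mixingPayoff_scalarSlabWellposed`)
launches the admissible scalar from the `ContDiffBump` datum centred at `x₀` (`rIn = r/2`,
`rOut = r`); `MIX(r, δ*)` says `∫ θ(T−r²/2)² ≤ δ*² ∫ θ(T−r²)²` while F says
`c₁² ∫ θ(T−r²)² < ∫ θ(T−r²/2)²`, and `δ*² ≤ c₁²`: contradiction, hence boundedness. -/
theorem mixingPayoff_iff_mixingForcesTypeI :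
    MixingPayoff ↔
    (∃ δ : ℝ, 0 < δ ∧ ∃ K : ℝ, 0 < K ∧
      ∀ (T : ℝ) (u : ℝ → E3 → E3) (p : ℝ → E3 → ℝ), 0 < T →
      IsClassicalNSSolutionOn (Set.Ico 0 T) 1 0 u p → IsLerayHopfOn T 1 0 (u 0) u →
      HasRapidSpatialDecay (u 0) → ∀ x₀ : E3,
      (∃ r₀ : ℝ, 0 < r₀ ∧ ∀ r ∈ Set.Ioo 0 r₀, DissipatesAtScale u T x₀ r δ) →
      ∃ r₁ : ℝ, 0 < r₁ ∧ ∀ t ∈ Set.Ioo (T - r₁ ^ 2) T, ∀ x ∈ Metric.ball x₀ r₁,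
        Real.sqrt (T - t) * ‖u t x‖ ≤ K) := by
  constructor
  · -- `P → H`: boundedness near `(T, x₀)` gives the Type-I(1) bound on a smaller cylinder.
    rintro ⟨δ, hδ, hP⟩
    refine ⟨δ, hδ, 1, one_pos, ?_⟩
    intro T u p hT hcl hLH hdec x₀ hmix
    obtain ⟨r₀, hr₀, hmix⟩ := hmix
    obtain ⟨ρ, hρ, M, hM⟩ := hP T hT u p hcl hLH hdec x₀ ⟨r₀, hr₀, fun r hr => hmix r hr⟩
    have hM0 : 0 < max M 0 + 1 := by positivity
    set r₁ : ℝ := min ρ (1 / (max M 0 + 1)) with hr₁_def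
    have hr₁ : 0 < r₁ := lt_min hρ (by positivity)
    have hr₁ρ : r₁ ≤ ρ := min_le_left _ _
    have hr₁M : r₁ * (max M 0 + 1) ≤ 1 := by
      have h := min_le_right ρ (1 / (max M 0 + 1))
      rw [← hr₁_def] at h
      calc r₁ * (max M 0 + 1) ≤ 1 / (max M 0 + 1) * (max M 0 + 1) :=
            mul_le_mul_of_nonneg_right h hM0.le
        _ = 1 := by field_simp
    refine ⟨r₁, hr₁, fun t ht x hx => ?_⟩
    have htρ : t ∈ Set.Ioo (T - ρ ^ 2) T := by
      refine ⟨lt_of_le_of_lt ?_ ht.1, ht.2⟩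
      nlinarith [pow_le_pow_left₀ hr₁.le hr₁ρ 2]
    have hxρ : x ∈ Metric.ball x₀ ρ := Metric.ball_subset_ball hr₁ρ hx
    have hux : ‖u t x‖ ≤ max M 0 := (hM t htρ x hxρ).trans (le_max_left _ _)
    have hTt : 0 ≤ T - t := by linarith [ht.2]
    have hsqrt : Real.sqrt (T - t) ≤ r₁ := by
      rw [show r₁ = Real.sqrt (r₁ ^ 2) by rw [Real.sqrt_sq hr₁.le]]
      exact Real.sqrt_le_sqrt (by linarith [ht.1])
    calc Real.sqrt (T - t) * ‖u t x‖ ≤ r₁ * max M 0 :=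
          mul_le_mul hsqrt hux (norm_nonneg _) hr₁.le
      _ ≤ r₁ * (max M 0 + 1) := by nlinarith
      _ ≤ 1 := hr₁M
  · -- `H → P`: the composition of line `birth` with the landed W and F.
    rintro ⟨δH, hδH, K, hK, hH⟩
    obtain ⟨c₁, hc₁, hF⟩ := mixingPayoff_typeIFloor K hK
    have hδpos : 0 < min δH (c₁ / 2) := lt_min hδH (by positivity)
    refine ⟨min δH (c₁ / 2), hδpos, ?_⟩
    intro T hT u p hcl hLH hdec x₀ hmix
    obtain ⟨r₀, hr₀, hmix⟩ := hmix
    -- Step 1 (H): cofinal `δ*`-mixing ⇒ cofinal `δ_H`-mixing (monotonicity) ⇒ Type-I(K).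
    have hTI : ∃ r₁ : ℝ, 0 < r₁ ∧ ∀ t ∈ Set.Ioo (T - r₁ ^ 2) T, ∀ x ∈ Metric.ball x₀ r₁,
        Real.sqrt (T - t) * ‖u t x‖ ≤ K := by
      refine hH T u p hT hcl hLH hdec x₀ ⟨r₀, hr₀, fun r hr => ?_⟩
      have h : DissipatesAtScale u T x₀ r (min δH (c₁ / 2)) := hmix r hr
      exact h.mono hδpos.le (min_le_left _ _)
    -- Step 2 (F): the floor scale `r₂` below which bump data keep the fraction `c₁²`.
    obtain ⟨r₂, hr₂, hfl⟩ := hF T u p hT hcl x₀ hTI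
    -- Step 3: a scale `r` below `r₀`, `r₂` and with `r² < T`.
    obtain ⟨r, hr, hrr₀, hrr₂, hrT⟩ : ∃ r : ℝ, 0 < r ∧ r < r₀ ∧ r < r₂ ∧ r ^ 2 < T := by
      have h₁ : min (min r₀ r₂) (Real.sqrt T) ≤ r₀ := (min_le_left _ _).trans (min_le_left _ _)
      have h₂ : min (min r₀ r₂) (Real.sqrt T) ≤ r₂ := (min_le_left _ _).trans (min_le_right _ _)
      have h₃ : min (min r₀ r₂) (Real.sqrt T) ≤ Real.sqrt T := min_le_right _ _
      have hm : 0 < min (min r₀ r₂) (Real.sqrt T) :=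
        lt_min (lt_min hr₀ hr₂) (Real.sqrt_pos.2 hT)
      have hsq : Real.sqrt T ^ 2 = T := Real.sq_sqrt hT.le
      refine ⟨min (min r₀ r₂) (Real.sqrt T) / 2, by positivity, by linarith, by linarith, ?_⟩
      nlinarith [Real.sqrt_nonneg T]
    -- Step 4 (W): the admissible scalar launched by the bump datum centred at `x₀`.
    let φ : ContDiffBump x₀ := ⟨r / 2, r, by positivity, by linarith⟩
    obtain ⟨θ, hsm, hdecay, hpde, hθ₀⟩ :=
      mixingPayoff_scalarSlabWellposed T u p hT hcl hLH hdec r hr hrT φ φ.contDiff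
        φ.hasCompactSupport
    have hsupp : Function.support (θ (T - r ^ 2)) ⊆ Metric.ball x₀ r := by
      rw [hθ₀, φ.support_eq]
    -- Step 5: `MIX(r, δ*)` on `θ` versus the floor on `θ`.
    have hM : ∫ x, (θ (T - r ^ 2 / 2) x) ^ 2 ≤
        (min δH (c₁ / 2)) ^ 2 * ∫ x, (θ (T - r ^ 2) x) ^ 2 :=
      hmix r ⟨hr, hrr₀⟩ θ hsm hdecay hpde hsupp
    have hL : c₁ ^ 2 * ∫ x, (θ (T - r ^ 2) x) ^ 2 < ∫ x, (θ (T - r ^ 2 / 2) x) ^ 2 :=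
      hfl r ⟨hr, hrr₂⟩ θ hsm hdecay hpde
        (fun x => by rw [hθ₀]; exact φ.nonneg)
        (fun x => by rw [hθ₀]; exact φ.le_one)
        (fun x hx => by rw [hθ₀]; exact φ.one_of_mem_closedBall hx)
        hsupp
    have hX : 0 ≤ ∫ x, (θ (T - r ^ 2) x) ^ 2 := integral_nonneg fun _ => sq_nonneg _
    have hδc : (min δH (c₁ / 2)) ^ 2 ≤ c₁ ^ 2 :=
      pow_le_pow_left₀ hδpos.le ((min_le_right _ _).trans (by linarith)) 2
    have hlt : c₁ ^ 2 * ∫ x, (θ (T - r ^ 2) x) ^ 2 < c₁ ^ 2 * ∫ x, (θ (T - r ^ 2) x) ^ 2 :=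
      hL.trans_le (hM.trans (mul_le_mul_of_nonneg_right hδc hX))
    exact absurd hlt (lt_irrefl _)

/-- **The crux reduced to its open heart** (`H → MixingPayoff`, the forward content of line
`birth`): if cofinal `δ`-mixing forces a Type-I(K) bound for some absolute `δ, K > 0`, then
`MixingPayoff` holds. -/
theorem mixingPayoff_of_mixingForcesTypeI
    (hH : ∃ δ : ℝ, 0 < δ ∧ ∃ K : ℝ, 0 < K ∧
      ∀ (T : ℝ) (u : ℝ → E3 → E3) (p : ℝ → E3 → ℝ), 0 < T →
      IsClassicalNSSolutionOn (Set.Ico 0 T) 1 0 u p → IsLerayHopfOn T 1 0 (u 0) u →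
      HasRapidSpatialDecay (u 0) → ∀ x₀ : E3,
      (∃ r₀ : ℝ, 0 < r₀ ∧ ∀ r ∈ Set.Ioo 0 r₀, DissipatesAtScale u T x₀ r δ) →
      ∃ r₁ : ℝ, 0 < r₁ ∧ ∀ t ∈ Set.Ioo (T - r₁ ^ 2) T, ∀ x ∈ Metric.ball x₀ r₁,
        Real.sqrt (T - t) * ‖u t x‖ ≤ K) :
    MixingPayoff :=
  mixingPayoff_iff_mixingForcesTypeI.2 hH

/-- **Necessity of the open heart** (`MixingPayoff → H`): the crux implies that cofinal
`δ`-mixing forces the Type-I(1) bound (boundedness near `(T, x₀)` and a smaller cylinder). -/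
theorem mixingForcesTypeI_of_mixingPayoff (hP : MixingPayoff) :
    ∃ δ : ℝ, 0 < δ ∧ ∃ K : ℝ, 0 < K ∧
      ∀ (T : ℝ) (u : ℝ → E3 → E3) (p : ℝ → E3 → ℝ), 0 < T →
      IsClassicalNSSolutionOn (Set.Ico 0 T) 1 0 u p → IsLerayHopfOn T 1 0 (u 0) u →
      HasRapidSpatialDecay (u 0) → ∀ x₀ : E3,
      (∃ r₀ : ℝ, 0 < r₀ ∧ ∀ r ∈ Set.Ioo 0 r₀, DissipatesAtScale u T x₀ r δ) →
      ∃ r₁ : ℝ, 0 < r₁ ∧ ∀ t ∈ Set.Ioo (T - r₁ ^ 2) T, ∀ x ∈ Metric.ball x₀ r₁,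
        Real.sqrt (T - t) * ‖u t x‖ ≤ K :=
  mixingPayoff_iff_mixingForcesTypeI.1 hP

end Summit.NavierStokesRegularity.NavierStokesRegularity.Theorems

end
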